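import Literature.AlgebraicGeometry.Milne1999.LefschetzCentraliser
import Literature.AlgebraicGeometry.HodgeTheory.AbelianVarietyHodgeFullnessHolds
import HarnessLib

/-!
# Milne 1999 (Duke 96) Remark 1.2 on `H¹`: the centraliser of `C(A) ⊗ ℂ` is `End⁰(A) ⊗ ℂ` — unconditionally

Family `hodge`, layer `Literature/AlgebraicGeometry/Milne1999`, namespace
`Literature.AlgebraicGeometry.Milne1999` (D-0022). Sequel of `Milne1999/LefschetzCentraliser` (Milne's
centraliser `C(A)` — the centraliser of `End⁰(A)` in `End(V(A))` — and the groups `S(A)`, `G(A)` of a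
complex abelian variety, read on `H¹(A(ℂ); ℂ)`; cell `pub-hodgecm2`, literature fan-out row INFRA-04-2′,
binder table `HOME/lit/milne.md` row M27). ONE theorem, no definition, no named fact (D-0026), net debt 0.

[Milne1999LefschetzClasses] §1 Remark 1.2 (p. 643): «the centralizer of `C(A)` in `End_k(V(A))` is
`End⁰(A) ⊗_ℚ k`» (Milne: from the semisimplicity of `End⁰(A)`, double centraliser theorem). The companion
file proved it on `H¹(A(ℂ); ℂ)` GRANTED Riemann's theorem
(`centralizer_centralizerAlgebra_eq_span_of_riemann (hR : HodgeTheory.DeligneMilne1982_Thm_6_20_full)`: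
an endomorphism commuting with `C(A) ⊗ ℂ` commutes with `Hg′(A)(ℂ)|_{H¹} ⊆ (C(A) ⊗ ℂ)^×`, hence is a
`ℂ`-combination of the `φ^*`, `φ ∈ End(A)`, by Deligne 1982 I Prop. 3.4 with Riemann's theorem). Riemann's
theorem (Deligne–Milne, LNM 900, II Thm. 6.20: fullness of `A ↦ H¹_B(A)`) is now the tree THEOREM
`HodgeTheory.deligneMilne1982_Thm_6_20_full_holds` (`HodgeTheory/AbelianVarietyHodgeFullnessHolds.lean`:
uniformisation by the exponential map, [LangeBirkenhake1992] Lemma 1.1.2, lattice coordinates on `H¹`, GAGA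
for maps), so Remark 1.2 on `H¹` holds with no hypothesis: `centralizer_centralizerAlgebra_eq_span`.

Not here: Remark 1.2 on the full `V(A) = H*` and over an arbitrary field `k ⊇ ℚ` (the tree reads `C(A)` on
complex Betti `H¹` only), and the semisimplicity road of the printed proof.

## References

* J. S. Milne, *Lefschetz classes on abelian varieties*, Duke Math. J. 96 (1999) 639–675, §1 Remark 1.2.
  [Milne1999LefschetzClasses]
* P. Deligne, *Hodge cycles on abelian varieties*, LNM 900 (1982), I §3 Prop. 3.4. [Deligne1982HodgeCycles]
* P. Deligne, J. S. Milne, *Tannakian categories*, LNM 900 (1982), II Thm. 6.20. [DeligneMilne1982Tannakian]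
-/

noncomputable section

open CategoryTheory
open Literature.AlgebraicTopology.SingularHomology
open Literature.AlgebraicGeometry.HodgeTheory
open Literature.AlgebraicGeometry.Motives
open Literature.AlgebraicGeometry.VanGeemen1994 (pullbackOne)

namespace Literature.AlgebraicGeometry.Milne1999

/-- **Milne 1999 Remark 1.2, on `H¹(A(ℂ); ℂ)`, UNCONDITIONALLY** («the centralizer of `C(A)` in
`End_k(V(A))` is `End⁰(A) ⊗_ℚ k`»): for every complex abelian variety `A`, the centraliser of Milne's
centraliser algebra `C(A) ⊗ ℂ = centralizerAlgebra A` in `End_ℂ H¹(A(ℂ); ℂ)` is exactly the `ℂ`-span of the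
pull-backs `φ^*` (`pullbackOne A φ`), `φ ∈ End(A)` — the image of `End⁰(A) ⊗ ℂ`. Proof: the companion
file's `centralizer_centralizerAlgebra_eq_span_of_riemann` (`⊇` elementary; `⊆` by Deligne 1982 I Prop. 3.4
through `Hg′(A)(ℂ)|_{H¹} ⊆ (C(A) ⊗ ℂ)^×`) at the tree theorem `deligneMilne1982_Thm_6_20_full_holds`
(Riemann's theorem, Deligne–Milne II Thm. 6.20). [cite: Milne1999LefschetzClasses, §1 Remark 1.2 (p. 643)]
[cite: Deligne1982HodgeCycles, I §3 Prop. 3.4] [cite: DeligneMilne1982Tannakian, II Thm. 6.20] -/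
theorem centralizer_centralizerAlgebra_eq_span (A : AbelianVariety ℂ) :
    Subalgebra.toSubmodule (Subalgebra.centralizer ℂ
        (centralizerAlgebra A : Set (Module.End ℂ (complexBetti A.X 1)))) =
      Submodule.span ℂ (Set.range fun φ : A ⟶ A ↦ pullbackOne A φ) :=
  centralizer_centralizerAlgebra_eq_span_of_riemann A deligneMilne1982_Thm_6_20_full_holds

/-- **Consequence (membership form of Remark 1.2 on `H¹`)**: an endomorphism `T` of `H¹(A(ℂ); ℂ)` commutes
with every element of `C(A) ⊗ ℂ` iff it is a `ℂ`-combination of pull-backs `φ^*`, `φ ∈ End(A)`.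
[cite: Milne1999LefschetzClasses, §1 Remark 1.2 (p. 643)] -/
theorem mem_centralizer_centralizerAlgebra_iff (A : AbelianVariety ℂ) (T : Module.End ℂ (complexBetti A.X 1)) :
    T ∈ Subalgebra.centralizer ℂ (centralizerAlgebra A : Set (Module.End ℂ (complexBetti A.X 1))) ↔
      T ∈ Submodule.span ℂ (Set.range fun φ : A ⟶ A ↦ pullbackOne A φ) := by
  rw [← Subalgebra.mem_toSubmodule, centralizer_centralizerAlgebra_eq_span A]

end Literature.AlgebraicGeometry.Milne1999

end
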